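import Summits.AtomisticToContinuum.BoseEinsteinCondensation.Theses.BECInsertionVariance

/-!
# Route `BECInsertionVariance`, assembly item `Assembly` (stmt-AtomisticToContinuum-12071)

Settles the assembly item `stmt-AtomisticToContinuum-12071` of route
`route-AtomisticToContinuum-BECInsertionVariance`: the implication

  `GroundStateHyperuniform → OneBodyLogHarnack → EntropyFromStructure → GroundStateAccessible →
    TruncatedSwapJensen → GroundStateCondensate → EntropyFrame → BoseEinsteinCondensation`

(the audited sub-problem abbrev `_root_.BoseEinsteinCondensation`, by name).

The hypotheses of `Assembly` are those of the route's deciding theorem `closes` except for the glue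
item `EntropyTargetGlue` (stmt-AtomisticToContinuum-14107, pure filter bookkeeping), which is
therefore proved here outright as `becInsertionVariance_entropyTargetGlue_proof`: fix a repulsive
finite-range `v`; take `ρ₀` the minimum of the four densities supplied by
`GroundStateHyperuniform`, `OneBodyLogHarnack`, `EntropyFromStructure`, `GroundStateAccessible`;
for `0 < ρ < ρ₀` take `C_H` from H and `C_L` from L, then `C` from R at `(C_H, C_L)`; intersect
the four eventual sets in `n` — R's two structural hypotheses are verbatim the bodies of H and L,
its mass hypothesis is verbatim the body of `GroundStateAccessible`, and the target's body is the
conjunction ⟨mass ≥ 1/2, entropy ≤ C⟩.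
With the target `InsertionEntropyBound` in hand, `EntropyFrame` applied to it, to
`TruncatedSwapJensen` and to `GroundStateCondensate` is the conjunct.
Pure logic; no analytic content lives here.

References: [LSSY2005, §1.2 (1.16)–(1.19)] (the conjunct being assembled), [PenroseOnsager1956]
(the criterion tr γ² ≤ N λ_max behind the frame).
-/

namespace Summit.AtomisticToContinuum.BoseEinsteinCondensation.Theorems

open Summit.AtomisticToContinuum.BoseEinsteinCondensation.Theses.BECInsertionVariance

/-- Glue item `EntropyTargetGlue` of route `BECInsertionVariance` (stmt-AtomisticToContinuum-14107,
exact route decl, proved outright): the three cruxes `GroundStateHyperuniform` (H),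
`OneBodyLogHarnack` (L), `EntropyFromStructure` (R) together with `GroundStateAccessible` give the
route target `InsertionEntropyBound`. Proof: `ρ₀ := min (min ρ_H ρ_L) (min ρ_R ρ_A)`; for
`0 < ρ < ρ₀` the constants `C_H`, `C_L` of H and L feed R, which returns `C`; on the intersection of
the four eventual sets in `n`, R's hypotheses are literally the conclusions of H, L and the
accessibility statement, and the target is ⟨accessible mass ≥ 1/2, accessible entropy ≤ C⟩.
[folklore] -/
theorem becInsertionVariance_entropyTargetGlue_proof :
    Summit.AtomisticToContinuum.BoseEinsteinCondensation.Theses.BECInsertionVariance.EntropyTargetGlue := by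
  unfold Theses.BECInsertionVariance.EntropyTargetGlue
  intro hH hL hR hAcc v hv
  obtain ⟨ρH, hρH, hH⟩ := hH v hv
  obtain ⟨ρL, hρL, hL⟩ := hL v hv
  obtain ⟨ρR, hρR, hR⟩ := hR v hv
  obtain ⟨ρA, hρA, hA⟩ := hAcc v hv
  refine ⟨min (min ρH ρL) (min ρR ρA), lt_min (lt_min hρH hρL) (lt_min hρR hρA), ?_⟩
  intro ρ hρ hρlt
  have hHL : ρ < min ρH ρL := lt_of_lt_of_le hρlt (min_le_left _ _)
  have hRA : ρ < min ρR ρA := lt_of_lt_of_le hρlt (min_le_right _ _)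
  obtain ⟨C_H, hCH⟩ := hH ρ hρ (lt_of_lt_of_le hHL (min_le_left _ _))
  obtain ⟨C_L, hCL⟩ := hL ρ hρ (lt_of_lt_of_le hHL (min_le_right _ _))
  obtain ⟨C, hC⟩ := hR ρ hρ (lt_of_lt_of_le hRA (min_le_left _ _)) C_H C_L
  have hAn := hA ρ hρ (lt_of_lt_of_le hRA (min_le_right _ _))
  refine ⟨C, ?_⟩
  filter_upwards [hCH, hCL, hC, hAn] with n h₁ h₂ h₃ h₄
  exact ⟨h₄, h₃ h₁ h₂ h₄⟩

/-- **Item stmt-AtomisticToContinuum-12071** (`Assembly` of route `BECInsertionVariance`, exact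
route decl): given `hH : GroundStateHyperuniform`, `hL : OneBodyLogHarnack`,
`hR : EntropyFromStructure`, `hAcc : GroundStateAccessible`, `hJ : TruncatedSwapJensen`,
`hCnd : GroundStateCondensate` and the frame `hF : EntropyFrame`, the term
`hF (becInsertionVariance_entropyTargetGlue_proof hH hL hR hAcc) hJ hCnd` is
`BoseEinsteinCondensation`. Pure composition of the route's hypotheses (the route's deciding
theorem `closes` with the glue item discharged). [folklore] -/
theorem becInsertionVariance_assembly_proof :
    Summit.AtomisticToContinuum.BoseEinsteinCondensation.Theses.BECInsertionVariance.Assembly := by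
  unfold Theses.BECInsertionVariance.Assembly
  intro hH hL hR hAcc hJ hCnd hF
  exact hF (becInsertionVariance_entropyTargetGlue_proof hH hL hR hAcc) hJ hCnd

end Summit.AtomisticToContinuum.BoseEinsteinCondensation.Theorems
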